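import Summits.ABC.StewartYu.GenThreeInductionArch
import Summits.ABC.StewartYu.GenThreeStepTwo
import Literature.Barriers.ABC.BakerMethodBoundsBakerWustholzProofs
import HarnessLib

/-!
# Cell abc-stewartyu, WP-L.A shell (parcel P-A1): the LIOUVILLE INEQUALITY (Nesterenko 2003, Lemma 2.3),
# the trivial regime (Cor. 2.5), the BASE RANKS `n = 0, 1` (Cor. 2.4) of the archimedean dichotomy, and the
# crux text from the dichotomy at ranks `≥ 2`

`Summits/ABC/StewartYu/GenThreeBaseArch.lean` — cell `abc-stewartyu` (HOME `run/shared/lean/pub/abc-stewartyu/`),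
route `YuMatveevShapeRat` (rung A1.L, crux r2 `ArchCoreRat`), seat p4 (g9), parcel WP-L.A P-A1; the
ARCHIMEDEAN TWIN of `Summits/ABC/StewartYu/GenThreeBaseOdd.lean` (p4-g3).  Theorems only.

Matveev's induction (`GenThreeInductionArch.core_of_dichotomy`) needs the dichotomy `DichotomyArch C n` at
EVERY rank.  Ranks `0` and `1` never see the analytic frame: rank `0` is vacuous (`b ≠ 0` on `Fin 0`), and
rank `1` is Nesterenko's Cor. 2.4 — for a positive rational `a ≠ 1` and an integer `b ≠ 0`,
`|b log a| ≥ |log a| ≥ ½ e^{−h(a)}` (Liouville + `|eᶻ − 1| ≤ 2|z|` for `|z| ≤ 1`), so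
`log |b log a| ≥ −2A ≥ −C(1)·A·log(eB)` as soon as `2 ≤ C 1`.  At every rank the same two inequalities
give the TRIVIAL REGIME (Cor. 2.5): `log|Λ| ≥ −∑ Aⱼ|bⱼ| − log 2` unconditionally
(`neg_sum_sub_log_two_le_log_abs_linearForm`), so the bound holds whenever
`∑ Aⱼ|bⱼ| + log 2 ≤ C(n)·Ω·log(eB)` and the frame may work under the negated inequality (print's (2.6)).

Contents: `exp_neg_logHeight₁_le_abs_sub_one` (Liouville for one rational: `|x − 1| ≥ e^{−h(x)}`, `x ≠ 1`),
`exp_neg_sum_le_abs_prod_zpow_sub_one` / `liouville_linearForm` (Lemma 2.3: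
`|e^Λ − 1| = |∏ aⱼ^{bⱼ} − 1| ≥ e^{−∑ Aⱼ|bⱼ|}`), `sum_weight_abs_le` (`∑ Aⱼ|bⱼ| ≤ n·Amax·B`),
`exp_linearForm` (`e^Λ = ∏ aⱼ^{bⱼ}`), `neg_sum_sub_log_two_le_log_abs_linearForm` (Cor. 2.5's inequality),
`bound_of_trivial_regime` / `regime_of_not_le` (Cor. 2.5 and (2.6)), `abs_log_le_weight` (print's third
weight condition `|log aⱼ| ≤ Aⱼ` is automatic over `ℚ`), `weight_le_prod` (`Aⱼ ≤ Ω`), `coreArch_zero`,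
`dichotomyArch_zero`, `coreArch_one`, `dichotomyArch_one` (Cor. 2.4), and `archCoreRat_of_dichotomy_two_le`:
the crux text `ArchCoreRat` from an admissible `C ≤ c₁ⁿ` with `2 ≤ C 1` and the dichotomy at ranks `≥ 2`.

WHAT THIS IS NOT: no analytic frame; no crux moves.

References: Yu. V. Nesterenko, *Linear forms in logarithms of rational numbers*, LNM 1819 (2003), Lemma 2.3,
(2.5), Cor. 2.4, Cor. 2.5, (2.6) (pp. 94–95).
-/

noncomputable section

open Finset

namespace Summit.ABC.StewartYu.GenThreeBaseArch

open Summit.ABC.StewartYu.GenThreeInductionArch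
open Summit.ABC.StewartYu.GenThreeStepTwo (logHeight₁_prod_zpow_le le_prod_of_one_le)

variable {n : ℕ}

/-! ### The Liouville inequality (Lemma 2.3) -/

/-- **Liouville's inequality for one rational number**: `|x − 1| ≥ e^{−h(x)}` for a rational `x ≠ 1`
(`x − 1 = (num − den)/den` with a nonzero integer numerator, and `den ≤ max(|num|, den) = H(x)`).
[cite: Nesterenko2003, Lemma 2.3 (p. 94)] -/
theorem exp_neg_logHeight₁_le_abs_sub_one {x : ℚ} (hx : x ≠ 1) :
    Real.exp (-Height.logHeight₁ x) ≤ |(x : ℝ) - 1| := by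
  have hH : Height.mulHeight₁ x = ((max x.num.natAbs x.den : ℕ) : ℝ) := Rat.mulHeight₁_eq_max x
  have hHpos : 0 < Height.mulHeight₁ x := Height.mulHeight₁_pos x
  rw [Height.logHeight₁_eq_log_mulHeight₁, Real.exp_neg, Real.exp_log hHpos]
  have hden : (0 : ℝ) < x.den := by exact_mod_cast x.den_pos
  have hnd : x.num - x.den ≠ 0 := by
    intro h
    apply hx
    have hnum : (x.num : ℚ) = x.den := by exact_mod_cast (sub_eq_zero.mp h)
    have := Rat.num_div_den x
    rw [hnum, div_self (by exact_mod_cast x.den_nz)] at this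
    exact this.symm
  have hsub : (x : ℝ) - 1 = ((x.num - x.den : ℤ) : ℝ) / x.den := by
    rw [Rat.cast_def]
    field_simp
    push_cast
    ring
  have h1 : (1 : ℝ) ≤ |((x.num - x.den : ℤ) : ℝ)| := by exact_mod_cast Int.one_le_abs hnd
  have hdenH : (x.den : ℝ) ≤ Height.mulHeight₁ x := by
    rw [hH]; exact_mod_cast le_max_right _ _
  rw [hsub, abs_div, abs_of_pos hden]
  calc (Height.mulHeight₁ x)⁻¹ ≤ (x.den : ℝ)⁻¹ := by
        rw [inv_le_inv₀ hHpos hden]; exact hdenH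
    _ = 1 / x.den := (one_div _).symm
    _ ≤ |((x.num - x.den : ℤ) : ℝ)| / x.den := div_le_div_of_nonneg_right h1 hden.le

/-- **Lemma 2.3 (Liouville inequality), product form**: if `h(aⱼ) ≤ Aⱼ` and `∏ aⱼ^{bⱼ} ≠ 1` then
`|∏ aⱼ^{bⱼ} − 1| ≥ e^{−∑ Aⱼ|bⱼ|}` (`h(∏ aⱼ^{bⱼ}) ≤ ∑ |bⱼ| h(aⱼ)`). [cite: Nesterenko2003, Lemma 2.3 (p. 94)] -/
theorem exp_neg_sum_le_abs_prod_zpow_sub_one (a : Fin n → ℚ) (A : Fin n → ℝ)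
    (hA : ∀ j, Height.logHeight₁ (a j) ≤ A j) (b : Fin n → ℤ) (hne : ∏ j, a j ^ b j ≠ 1) :
    Real.exp (-(∑ j, A j * |(b j : ℝ)|)) ≤ |(∏ j, ((a j : ℝ)) ^ b j) - 1| := by
  have h := exp_neg_logHeight₁_le_abs_sub_one hne
  rw [cast_prod_zpow] at h
  refine le_trans ?_ h
  exact Real.exp_le_exp.mpr (neg_le_neg (logHeight₁_prod_zpow_le a A hA b))

/-- **`e^Λ = ∏ aⱼ^{bⱼ}`** for `Λ = ∑ bⱼ log aⱼ`, positive rationals `aⱼ`. [cite: Nesterenko2003, Lemma 2.3] -/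
theorem exp_linearForm (a : Fin n → ℚ) (ha : ∀ j, 0 < a j) (b : Fin n → ℤ) :
    Real.exp (∑ j, (b j : ℝ) * Real.log (a j : ℝ)) = ∏ j, ((a j : ℝ)) ^ b j := by
  rw [← log_cast_prod_zpow a ha b, Real.exp_log (by exact_mod_cast prod_zpow_pos a ha b), cast_prod_zpow]

/-- **Lemma 2.3 as printed**: `|e^Λ − 1| ≥ e^{−∑ Aⱼ|bⱼ|}` (`≥ e^{−nAB}`) for `Λ = ∑ bⱼ log aⱼ`, positive
multiplicatively independent rationals `aⱼ` with `h(aⱼ) ≤ Aⱼ`, and `b ≠ 0`.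
[cite: Nesterenko2003, Lemma 2.3 (p. 94)] -/
theorem liouville_linearForm (a : Fin n → ℚ) (ha : ∀ j, 0 < a j)
    (hind : ∀ μ : Fin n → ℤ, ∏ j, a j ^ μ j = 1 → μ = 0) (A : Fin n → ℝ)
    (hA : ∀ j, Height.logHeight₁ (a j) ≤ A j) (b : Fin n → ℤ) (hb : b ≠ 0) :
    Real.exp (-(∑ j, A j * |(b j : ℝ)|)) ≤
      |Real.exp (∑ j, (b j : ℝ) * Real.log (a j : ℝ)) - 1| := by
  rw [exp_linearForm a ha b]
  exact exp_neg_sum_le_abs_prod_zpow_sub_one a A hA b fun h1 => hb (hind b h1)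

/-- `∑ Aⱼ|bⱼ| ≤ n·Amax·B` when `0 ≤ Aⱼ ≤ Amax` and `|bⱼ| ≤ B`. [cite: Nesterenko2003, Lemma 2.3 (`e^{−nAB}`)] -/
theorem sum_weight_abs_le (A : Fin n → ℝ) {Amax : ℝ} (hA0 : ∀ j, 0 ≤ A j) (hAmax : ∀ j, A j ≤ Amax)
    (b : Fin n → ℤ) {B : ℝ} (hB : ∀ j, (|b j| : ℝ) ≤ B) :
    ∑ j, A j * |(b j : ℝ)| ≤ n * Amax * B := by
  calc ∑ j, A j * |(b j : ℝ)| ≤ ∑ _j : Fin n, Amax * B :=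
        Finset.sum_le_sum fun j _ => mul_le_mul (hAmax j) (hB j) (abs_nonneg _) ((hA0 j).trans (hAmax j))
    _ = n * Amax * B := by
        rw [Finset.sum_const, Finset.card_univ, Fintype.card_fin, nsmul_eq_mul, mul_assoc]

/-! ### The trivial regime (Cor. 2.5) and the working regime (2.6) -/

/-- **The inequality behind Cor. 2.5, unconditionally**: for positive multiplicatively independent
rationals `aⱼ` with `h(aⱼ) ≤ Aⱼ` and `b ≠ 0`, `log |∑ bⱼ log aⱼ| ≥ −∑ Aⱼ|bⱼ| − log 2`
(`|Λ| ≥ ½|e^Λ − 1| ≥ ½e^{−∑ Aⱼ|bⱼ|}` if `|Λ| ≤ 1`, else `|Λ| > 1`). [cite: Nesterenko2003, Cor 2.5 (p. 94–95)] -/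
theorem neg_sum_sub_log_two_le_log_abs_linearForm (a : Fin n → ℚ) (ha : ∀ j, 0 < a j)
    (hind : ∀ μ : Fin n → ℤ, ∏ j, a j ^ μ j = 1 → μ = 0) (A : Fin n → ℝ)
    (hA : ∀ j, Height.logHeight₁ (a j) ≤ A j) (b : Fin n → ℤ) (hb : b ≠ 0) :
    -(∑ j, A j * |(b j : ℝ)|) - Real.log 2 ≤ Real.log |∑ j, (b j : ℝ) * Real.log (a j : ℝ)| := by
  set Λ : ℝ := ∑ j, (b j : ℝ) * Real.log (a j : ℝ) with hΛ
  have hΛ0 : Λ ≠ 0 := linearForm_ne_zero a ha hind b hb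
  have hS0 : 0 ≤ ∑ j, A j * |(b j : ℝ)| :=
    Finset.sum_nonneg fun j _ =>
      mul_nonneg ((Height.zero_le_logHeight₁ _).trans (hA j)) (abs_nonneg _)
  have hlog2 : 0 ≤ Real.log 2 := Real.log_nonneg (by norm_num)
  rcases le_or_gt |Λ| 1 with h1 | h1
  · -- `|e^Λ − 1| ≤ 2|Λ|`
    have hup : |Real.exp Λ - 1| ≤ 2 * |Λ| := Real.abs_exp_sub_one_le h1
    have hlow := liouville_linearForm a ha hind A hA b hb
    have hpos : 0 < 2 * |Λ| := by positivity
    have h2 : Real.exp (-(∑ j, A j * |(b j : ℝ)|)) ≤ 2 * |Λ| := hlow.trans hup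
    have h3 := Real.log_le_log (Real.exp_pos _) h2
    rw [Real.log_exp, Real.log_mul (by norm_num) (abs_ne_zero.mpr hΛ0)] at h3
    linarith
  · have : 0 ≤ Real.log |Λ| := Real.log_nonneg h1.le
    linarith

/-- **Cor. 2.5 (the trivial regime)**: if `∑ Aⱼ|bⱼ| + log 2 ≤ C(n)·Ω·log(eB)` then the bound of `CoreArch`
holds for this datum. [cite: Nesterenko2003, Cor 2.5 (p. 94–95)] -/
theorem bound_of_trivial_regime {C : ℕ → ℝ} (a : Fin n → ℚ) (ha : ∀ j, 0 < a j)
    (hind : ∀ μ : Fin n → ℤ, ∏ j, a j ^ μ j = 1 → μ = 0) (A : Fin n → ℝ)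
    (hA : ∀ j, Height.logHeight₁ (a j) ≤ A j) (b : Fin n → ℤ) (hb : b ≠ 0) {B : ℝ}
    (h : ∑ j, A j * |(b j : ℝ)| + Real.log 2 ≤ C n * (∏ j, A j) * Real.log (Real.exp 1 * B)) :
    -(C n * (∏ j, A j) * Real.log (Real.exp 1 * B)) ≤
      Real.log |∑ j, (b j : ℝ) * Real.log (a j : ℝ)| := by
  have := neg_sum_sub_log_two_le_log_abs_linearForm a ha hind A hA b hb
  linarith

/-- **The working regime (2.6)**: under the NEGATED bound, `C(n)·Ω·log(eB) < ∑ Aⱼ|bⱼ| + log 2`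
(`≤ n·Amax·B + 1`). [cite: Nesterenko2003, (2.6) (p. 95)] -/
theorem regime_of_not_le {C : ℕ → ℝ} (a : Fin n → ℚ) (ha : ∀ j, 0 < a j)
    (hind : ∀ μ : Fin n → ℤ, ∏ j, a j ^ μ j = 1 → μ = 0) (A : Fin n → ℝ)
    (hA : ∀ j, Height.logHeight₁ (a j) ≤ A j) (b : Fin n → ℤ) (hb : b ≠ 0) {B : ℝ}
    (hneg : ¬ -(C n * (∏ j, A j) * Real.log (Real.exp 1 * B)) ≤
      Real.log |∑ j, (b j : ℝ) * Real.log (a j : ℝ)|) :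
    C n * (∏ j, A j) * Real.log (Real.exp 1 * B) < ∑ j, A j * |(b j : ℝ)| + Real.log 2 := by
  by_contra h
  exact hneg (bound_of_trivial_regime a ha hind A hA b hb (not_lt.mp h))

/-! ### The weights: `|log aⱼ| ≤ Aⱼ` is automatic over `ℚ`; `Aⱼ ≤ Ω` -/

/-- **Print's third weight condition is automatic over `ℚ`**: `|log a| ≤ h(a) ≤ A` for a positive rational
`a`. [cite: Nesterenko2003, (2.3) (p. 94)] -/
theorem abs_log_le_weight {a : ℚ} (ha : 0 < a) {A : ℝ} (hA : Height.logHeight₁ a ≤ A) :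
    |Real.log (a : ℝ)| ≤ A :=
  (Literature.Barriers.ABC.abs_log_le_logHeight₁ ha).trans hA

/-- Each weight is at most `Ω = ∏ Aₖ` when all weights are `≥ 1`. [folklore] -/
theorem weight_le_prod {A : Fin n → ℝ} (hA1 : ∀ j, 1 ≤ A j) (j : Fin n) : A j ≤ ∏ k, A k :=
  le_prod_of_one_le hA1 j

/-! ### The base ranks `0` and `1` (Cor. 2.4) -/

/-- Rank `0` of the internal statement is vacuous (`b ≠ 0` is impossible on `Fin 0`). [folklore] -/
theorem coreArch_zero (C : ℕ → ℝ) : CoreArch C 0 := by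
  intro a b A B _ _ _ _ hb _
  exact absurd (funext fun j => Fin.elim0 j) hb

/-- Rank `0` of the archimedean dichotomy is vacuous. [folklore] -/
theorem dichotomyArch_zero (C : ℕ → ℝ) : DichotomyArch C 0 :=
  fun a b A B ha hind hA hA1 hb hB => Or.inl (coreArch_zero C a b A B ha hind hA hA1 hb hB)

/-- **Cor. 2.4 — rank `1` of the internal statement**, for `2 ≤ C 1`: for a positive rational `a ≠ 1`
(independence) and an integer `b ≠ 0`, `log |b log a| ≥ log |log a| ≥ −h(a) − log 2 ≥ −2A ≥ −C(1)·A·log(eB)`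
(if `|log a| ≤ 1`: `|a − 1| = |e^{log a} − 1| ≤ 2|log a|` and Liouville; else `log|log a| > 0`).
[cite: Nesterenko2003, Cor 2.4 (p. 94)] -/
theorem coreArch_one {C : ℕ → ℝ} (hC : 2 ≤ C 1) : CoreArch C 1 := by
  intro a b A B ha hind hA hA1 hb hB
  have hb0 : b 0 ≠ 0 := by
    intro h0; apply hb; funext j
    have : j = 0 := Subsingleton.elim _ _
    rw [this, h0]; rfl
  have ha0 : 0 < a 0 := ha 0
  -- `a 0 ≠ 1` from multiplicative independence
  have ha1 : a 0 ≠ 1 := by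
    intro h1
    have h := hind (fun _ => 1) (by rw [Fin.prod_univ_one, h1, one_zpow])
    exact one_ne_zero (congrFun h 0)
  have hsum : ∑ j : Fin 1, (b j : ℝ) * Real.log (a j : ℝ) = (b 0 : ℝ) * Real.log (a 0 : ℝ) := by
    rw [Fin.sum_univ_one]
  have hprodA : ∏ j : Fin 1, A j = A 0 := by rw [Fin.prod_univ_one]
  rw [hsum, hprodA]
  set ℓ : ℝ := Real.log (a 0 : ℝ) with hℓ
  have hℓ0 : ℓ ≠ 0 := Real.log_ne_zero_of_pos_of_ne_one (by exact_mod_cast ha0) (by exact_mod_cast ha1)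
  have hA0 : 1 ≤ A 0 := hA1 0
  have hlogB : 1 ≤ Real.log (Real.exp 1 * B) := one_le_log_exp_one_mul (one_le_bound hb hB)
  -- `|b 0 · ℓ| ≥ |ℓ|`
  have hb1 : (1 : ℝ) ≤ |(b 0 : ℝ)| := by exact_mod_cast Int.one_le_abs hb0
  have hΛ : |ℓ| ≤ |(b 0 : ℝ) * ℓ| := by
    rw [abs_mul]
    calc |ℓ| = 1 * |ℓ| := (one_mul _).symm
      _ ≤ |(b 0 : ℝ)| * |ℓ| := mul_le_mul_of_nonneg_right hb1 (abs_nonneg _)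
  have hlogΛ : Real.log |ℓ| ≤ Real.log |(b 0 : ℝ) * ℓ| := Real.log_le_log (abs_pos.mpr hℓ0) hΛ
  -- the right-hand side is at least `2·A 0`
  have hR : 2 * A 0 ≤ C 1 * A 0 * Real.log (Real.exp 1 * B) := by
    have h1 : 2 * A 0 ≤ C 1 * A 0 := mul_le_mul_of_nonneg_right hC (by linarith)
    have h2 : C 1 * A 0 * 1 ≤ C 1 * A 0 * Real.log (Real.exp 1 * B) :=
      mul_le_mul_of_nonneg_left hlogB (by nlinarith)
    linarith
  rcases le_or_gt |ℓ| 1 with h1 | h1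
  · -- `|a − 1| ≤ 2|ℓ|` and Liouville `|a − 1| ≥ e^{−A}`
    have hup : |Real.exp ℓ - 1| ≤ 2 * |ℓ| := Real.abs_exp_sub_one_le h1
    rw [hℓ, Real.exp_log (by exact_mod_cast ha0)] at hup
    have hlow : Real.exp (-A 0) ≤ |((a 0 : ℚ) : ℝ) - 1| :=
      (Real.exp_le_exp.mpr (neg_le_neg (hA 0))).trans (exp_neg_logHeight₁_le_abs_sub_one ha1)
    have h2 : Real.exp (-A 0) ≤ 2 * |ℓ| := hlow.trans hup
    have h3 := Real.log_le_log (Real.exp_pos _) h2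
    rw [Real.log_exp, Real.log_mul (by norm_num) (abs_ne_zero.mpr hℓ0)] at h3
    have hlog2 : Real.log 2 ≤ 1 := by
      -- (= `Literature.Probability.LatticeModels.log_two_le_one`; re-derived to keep the import cone small)
      have := Real.log_le_sub_one_of_pos (by norm_num : (0 : ℝ) < 2)
      linarith
    linarith
  · have : 0 ≤ Real.log |ℓ| := Real.log_nonneg h1.le
    nlinarith

/-- **Cor. 2.4 — rank `1` of the archimedean dichotomy** (first branch), for `2 ≤ C 1`.
[cite: Nesterenko2003, Cor 2.4 (p. 94)] -/
theorem dichotomyArch_one {C : ℕ → ℝ} (hC : 2 ≤ C 1) : DichotomyArch C 1 :=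
  fun a b A B ha hind hA hA1 hb hB => Or.inl (coreArch_one hC a b A B ha hind hA hA1 hb hB)

/-! ### The crux text from the dichotomy at ranks `≥ 2` -/

/-- **The crux text `ArchCoreRat` from an admissible `C ≤ c₁ⁿ` with `2 ≤ C 1` and the archimedean dichotomy at
every rank `n ≥ 2`** (ranks `0, 1` are `dichotomyArch_zero`, `dichotomyArch_one`).
[cite: Nesterenko2003, Thm 2.2 from Cor 2.4 and Prop 2.6 (pp. 94–96); shape only] -/
theorem archCoreRat_of_dichotomy_two_le {C : ℕ → ℝ} {c₁ : ℝ} (hC : ∀ m, 0 ≤ C m ∧ C m ≤ c₁ ^ m)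
    (hC1 : 2 ≤ C 1) (hD : ∀ n, 2 ≤ n → DichotomyArch C n) :
    ∃ c : ℝ, ∀ (r : ℕ) (a : Fin r → ℚ) (b : Fin r → ℤ) (A : Fin r → ℝ) (B : ℝ),
      (∀ i, 0 < a i) →
      (∀ μ : Fin r → ℤ, ∏ i, a i ^ μ i = 1 → μ = 0) →
      (∀ i, Height.logHeight₁ (a i) ≤ A i) → (∀ i, 1 ≤ A i) →
      b ≠ 0 → (∀ i, (|b i| : ℝ) ≤ B) →
      -(c ^ r * (∏ i, A i) * Real.log (Real.exp 1 * B)) ≤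
        Real.log |∑ i, (b i : ℝ) * Real.log (a i : ℝ)| := by
  refine archCoreRat_of_core hC (core_of_dichotomy fun n => ?_)
  rcases Nat.lt_or_ge n 2 with hn | hn
  · interval_cases n
    · exact dichotomyArch_zero C
    · exact dichotomyArch_one hC1
  · exact hD n hn

end Summit.ABC.StewartYu.GenThreeBaseArch

end
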